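import Summits.AtomisticToContinuum.BoseEinsteinCondensation.Theses.BECNewtonPolicyIteration

/-!
# AtomisticToContinuum / BoseEinsteinCondensation — route `BECNewtonPolicyIteration`, assembly

Settles the assembly item `stmt-AtomisticToContinuum-8962` of route
`route-AtomisticToContinuum-BECNewtonPolicyIteration`: the implication
`PeriodicLandscapeBound → PeriodicRigidity → FlatModePeriodic → OccupationStabilityPeriodic →
LandscapeToPeriodicBEC → BoundaryTransferWeak → BoseEinsteinCondensation`.

The hypotheses of `Assembly` are, verbatim and in the same order, those of the route's deciding
theorem `closes`, so the assembly is that theorem curried; the composition is spelled out again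
below for the record: the glue item `LandscapeToPeriodicBEC`, fed with `PeriodicLandscapeBound`,
`PeriodicRigidity`, `FlatModePeriodic` and `OccupationStabilityPeriodic`, yields constant-mode BEC
of periodic near-minimisers for the given potential `v`, and the shared boundary transfer
`BoundaryTransferWeak` turns that into `HasGroundStateBEC v ρ` for all small `ρ`, i.e. the
conjunct `BoseEinsteinCondensation` (an `abbrev` of
`Literature.MathematicalPhysics.QuantumManyBody.BoseGas.BoseEinsteinCondensation`).
Pure logic; no analytic content lives here.
-/

namespace Summit.AtomisticToContinuum.BoseEinsteinCondensation.Theorems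

/-- Settles `stmt-AtomisticToContinuum-8962` (exact signature): the assembly of route
`BECNewtonPolicyIteration`, i.e. its six items imply the sub-problem statement
`BoseEinsteinCondensation`. Proof: for an admissible `v`, `BoundaryTransferWeak v` applied to the
periodic constant-mode BEC statement for `v` produced by `LandscapeToPeriodicBEC` from the four
remaining hypotheses. [folklore] -/
theorem becNewtonPolicyIteration_assembly_proof :
    Summit.AtomisticToContinuum.BoseEinsteinCondensation.Theses.BECNewtonPolicyIteration.Assembly := by
  unfold Theses.BECNewtonPolicyIteration.Assembly
  intro h₁ h₂ h₃ h₄ h₅ h₆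
  exact fun v hv => h₆ v hv (h₅ h₁ h₂ h₃ h₄ v hv)

end Summit.AtomisticToContinuum.BoseEinsteinCondensation.Theorems
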